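import Summits.CriticalPhenomena.CardyFormulaZ2.Theorems.CardyViaSLE6Assembly
import Summits.CriticalPhenomena.CardyFormulaZ2.Theorems.CardyViaSLE6SLE6HittingSandwich
import Summits.CriticalPhenomena.CardyFormulaZ2.Theses.CardySelfRefinement
import HarnessLib

/-!
# `InterfaceToCardy` (stmt-CriticalPhenomena-10278) modulo the `ℤ²` crossing/interface dictionary

Route `CardySelfRefinement`, support item
`Summit.CriticalPhenomena.CardyFormulaZ2.Theses.CardySelfRefinement.InterfaceToCardy` (SLE₆ for every
Dobrushin domain and every admissible `ℤ²`-discretisation family ⇒ Cardy's formula for bond-`ℤ²`).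
Its antecedent is verbatim the target `SLE6InterfaceLimit` of route `CardyViaSLE6`, whose assembly
`SLE6InterfaceLimit → InterfaceImpliesCrossing → CrossingImpliesInterface → SLE6HittingSandwich →
DiscretisationsExist → CardyFormulaZ2` is proved in `Theorems/CardyViaSLE6Assembly.lean`
(`CardyViaSLE6.assembly_proof`: open-set portmanteau along the mesh filter + the proved SLE₆
Cardy–Smirnov law `sle_six_measureReal_hitsBefore_holds`) and whose SLE₆ input
`SLE6HittingSandwich` is proved in `Theorems/CardyViaSLE6SLE6HittingSandwich.lean`
(`CardyViaSLE6.sle6HittingSandwich_proof`).  Hence `InterfaceToCardy` is reduced to the three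
remaining `CardyViaSLE6` items — the lattice content of the implication:

* `InterfaceImpliesCrossing` (stmt-CriticalPhenomena-11317, crux: thickened upper dictionary),
* `CrossingImpliesInterface` (stmt-CriticalPhenomena-11318, crux: thickened lower dictionary),
* `DiscretisationsExist` (stmt-CriticalPhenomena-11319, support: admissible families exist),

which is the informal plan of the item ("crossing = interface hits `(cd)` before `(bc)` up to
boundary three-arm events; portmanteau + `sle_six_measureReal_hitsBefore`") with everything but the
lattice dictionary and the family construction discharged.  (The other reduction, to the crux
`SLESixFamiliesGiveCardy` of route `CardyComplexCone`, is
`Theorems/CardySelfRefinementInterfaceToCardyBridge.lean`.)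
-/

namespace Summit.CriticalPhenomena.CardyFormulaZ2.Theorems.InterfaceToCardyDictionary

/-- `InterfaceToCardy` is, definitionally, "target of route `CardyViaSLE6` ⇒ Cardy":
`SLE6InterfaceLimit → CardyFormulaZ2` (the two antecedents are syntactically identical). [folklore] -/
theorem interfaceToCardy_iff_sle6InterfaceLimit_imp :
    Theses.CardySelfRefinement.InterfaceToCardy ↔
      (Theses.CardyViaSLE6.SLE6InterfaceLimit → _root_.CardyFormulaZ2) :=
  Iff.rfl

/-- **`InterfaceToCardy` modulo the lattice dictionary**: the item stmt-CriticalPhenomena-10278 of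
route `CardySelfRefinement` follows from the three `CardyViaSLE6` items `InterfaceImpliesCrossing`,
`CrossingImpliesInterface`, `DiscretisationsExist` (its own antecedent being
`CardyViaSLE6.SLE6InterfaceLimit` verbatim), by the proved assembly `CardyViaSLE6.assembly_proof`
and the proved sandwich `CardyViaSLE6.sle6HittingSandwich_proof`. [folklore] -/
theorem interfaceToCardy_of_dictionary (h3 : Theses.CardyViaSLE6.InterfaceImpliesCrossing)
    (h4 : Theses.CardyViaSLE6.CrossingImpliesInterface)
    (hD : Theses.CardyViaSLE6.DiscretisationsExist) :
    Theses.CardySelfRefinement.InterfaceToCardy :=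
  fun H => CardyViaSLE6.assembly_proof H h3 h4 CardyViaSLE6.sle6HittingSandwich_proof hD

end Summit.CriticalPhenomena.CardyFormulaZ2.Theorems.InterfaceToCardyDictionary
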